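import Summits.Langlands.Langlands.Theorems.ParityBlindBianchiTwoAdicBianchiProModularityLevelSqueezeDefsLoci
import HarnessLib

/-!
# Route `ParityBlindBianchi`, crux `TwoAdicBianchiProModularityLevel` (stmt-Langlands-15110): vocabulary of the
# line `dimension-squeeze`, part 3 — the Hecke-algebra datum and the AUT-core statement

Companion of the landed Defs files `…SqueezeDefs.lean` (p137908) and `…SqueezeDefsLoci.lean` (p139601); same
namespace as the checked skeleton `Cruxes/TwoAdicBianchiProModularityLevel/Lines/dimension_squeeze.lean`.
NOTHING IS ASSERTED.

* `HeckeAlgebraDatum M 𝓡 I U ϖ` — the HYPOTHESIS LIST of the landed reductions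
  `squeeze_heckeDimensionOf_of_heckeAlgebra` (AUT) and `squeeze_zariskiReadoutOf_of_heckeAlgebra` (READ) as one bundled
  object: a surjective `𝒪`-algebra map `q : R ↠ T` onto a reduced, `𝒪`-torsion-free, complete Noetherian local ring of
  Krull dimension `≥ 4`, through which every Hecke point of `V(I)` at level `U` factors, and all of whose
  `𝒪_{ℚ̄₂}`-valued `𝒪`-algebra points give Hecke points of `V(I)` at level `U`.  Intended instance: `T` = the reduced
  `I`-typed quotient of the big Hecke algebra `𝕋(U²)_𝔪 ⊗_{W(k₀)} 𝒪` of the `2`-power Bianchi tower, `q` = the map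
  given by Scholze's `𝕋`-valued determinant (Chenevier, Carayol) — its existence is then exactly
  SURJ ∧ TF ((c)-lite) ∧ DIM ((c) + Gee–Newton Prop. 54 + App. §6.3).
* (The `σ`-blind statement "under the hypotheses of AUT there is a tame level `U` with a Hecke-algebra datum for
  `V(typeIdealD)`" — the OPEN core of the automorphic stub, Gee–Newton's conjecture `dim 𝕋_𝔪 = 1 + dim B − l₀` in its
  INEQUALITY form for the typed quotient plus `2`-torsion-freeness, for `PGL₂` over an imaginary quadratic field at
  `p = 2` — is the registered stub `stub_heckeDatum` of the skeleton (v6) and, as a named `def AutCore : Prop`,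
  the crux workfile `Lines/dimension_squeeze_PromoteAutCore.lean`; it is deliberately NOT declared here, a conjecture
  not being a citable fact.)

References: GeeNewton2020 (arXiv:1609.06965) Prop. 54, Rem. 55, Prop. 57, Rem. 58, Conj. 23/27; CalegariEmerton2011 §1.
-/

noncomputable section

set_option linter.dupNamespace false -- `Summit.Langlands.Langlands` is the mandated namespace (D-0017)

open scoped NumberField MatrixGroups
open Polynomial IsDedekindDomain Field
open Literature.NumberTheory.GaloisRepresentations Literature.NumberTheory.Automorphic

namespace Summit.Langlands.Langlands.Cruxes.TwoAdicBianchiProModularityLevel.DimensionSqueeze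

/-- **A Hecke-algebra datum for `V(I)` at level `U`**: a surjective `𝒪`-algebra map `q : R ↠ T` onto a reduced,
`𝒪`-torsion-free, complete Noetherian local ring `T` of Krull dimension `≥ 4`, through which every Hecke point of `V(I)`
at level `U` factors, and every `𝒪_{ℚ̄₂}`-valued `𝒪`-algebra point `ψ` of which gives a Hecke point `ψ ∘ q` of `V(I)`
at level `U` — the hypothesis lists of `squeeze_heckeDimensionOf_of_heckeAlgebra` (AUT) and
`squeeze_zariskiReadoutOf_of_heckeAlgebra` (READ), bundled.  Intended: `T = (𝕋(U²)_𝔪 ⊗ 𝒪 ⧸ q(I))_red`.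
[cite: GeeNewton2020, Prop. 54 and Rem. 58] -/
structure HeckeAlgebraDatum {K : Type} [Field K] [NumberField K] {σ : FramedGaloisRep K (PadicAlgCl 2) 2}
    (M : Model σ) {S₀ : Finset ℕ} {h0 : (0 : ℕ) ∉ S₀} {h2 : 2 ∈ S₀}
    {hunr : ∀ v ∉ badSet K S₀, Deformation.IsUnramifiedAt v M.residual}
    (𝓡 : PolarizedDeformationRing (M.datum S₀ h0 h2 hunr)) (I : Ideal 𝓡.R)
    (U : Subgroup (GL (Fin 2) (FiniteAdeleRing (𝓞 K) K)))
    (ϖ : ∀ v : HeightOneSpectrum (𝓞 K), (v.adicCompletion K)ˣ) : Type 1 where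
  /-- The Hecke algebra. -/
  T : Type
  [instCommRing : CommRing T]
  [instIsLocalRing : IsLocalRing T]
  [instIsNoetherianRing : IsNoetherianRing T]
  [instIsAdicComplete : IsAdicComplete (IsLocalRing.maximalIdeal T) T]
  [instIsReduced : IsReduced T]
  [instAlgebra : Algebra M.𝒪 T]
  /-- The Galois-to-Hecke map `R ↠ T`. -/
  q : 𝓡.R →ₐ[M.𝒪] T
  /-- `q` is onto (SURJ). -/
  surjective : Function.Surjective q
  /-- Every Hecke point of `V(I)` at level `U` factors through `q` (FACTOR: the other half of SURJ — the
  Galois representation of a Hecke eigensystem is the specialisation of the one over `T`). -/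
  ker_le : RingHom.ker (q : 𝓡.R →+* T) ≤ M.heckeIdealOf 𝓡 I U ϖ
  /-- `T` is `𝒪`-torsion-free (TF). -/
  torsionFree : ∀ a : M.𝒪, a ≠ 0 → algebraMap M.𝒪 T a ∈ nonZeroDivisors T
  /-- The `𝒪_{ℚ̄₂}`-points of `T` are Hecke points of `V(I)` at level `U` (HECKE). -/
  points_hecke : ∀ ψ : T →+* O2, ψ.comp (algebraMap M.𝒪 T) = M.emb →
    ψ.comp (q : 𝓡.R →+* T) ∈ M.heckePointsOf 𝓡 I U ϖ
  /-- `dim T ≥ 4` (DIM). -/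
  four_le_dim : (4 : WithBot ℕ∞) ≤ ringKrullDim T

attribute [instance] HeckeAlgebraDatum.instCommRing HeckeAlgebraDatum.instIsLocalRing
  HeckeAlgebraDatum.instIsNoetherianRing HeckeAlgebraDatum.instIsAdicComplete HeckeAlgebraDatum.instIsReduced
  HeckeAlgebraDatum.instAlgebra

/-- REGISTERED SUB-GOAL `squeeze_heckeAlgebraDatum_factor` (projection, recorded so that the Defs file carries a
registered statement): a Hecke-algebra datum is a SURJECTIVE quotient of `R` through which every Hecke point of `V(I)`
factors. [folklore] -/
theorem squeeze_heckeAlgebraDatum_factor : ∀ (K : Type) [Field K] [NumberField K]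
    (σ : FramedGaloisRep K (PadicAlgCl 2) 2) (M : Model σ) (S₀ : Finset ℕ) (h0 : (0 : ℕ) ∉ S₀) (h2 : 2 ∈ S₀)
    (hunr : ∀ v ∉ badSet K S₀, Deformation.IsUnramifiedAt v M.residual)
    (𝓡 : PolarizedDeformationRing (M.datum S₀ h0 h2 hunr)) (I : Ideal 𝓡.R)
    (U : Subgroup (GL (Fin 2) (FiniteAdeleRing (𝓞 K) K)))
    (ϖ : ∀ v : HeightOneSpectrum (𝓞 K), (v.adicCompletion K)ˣ) (D : HeckeAlgebraDatum M 𝓡 I U ϖ),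
    Function.Surjective D.q ∧ RingHom.ker (D.q : 𝓡.R →+* D.T) ≤ M.heckeIdealOf 𝓡 I U ϖ :=
  fun _ _ _ _ _ _ _ _ _ _ _ _ _ D => ⟨D.surjective, D.ker_le⟩

end Summit.Langlands.Langlands.Cruxes.TwoAdicBianchiProModularityLevel.DimensionSqueeze

end
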